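import Literature.Computability.Complexity.ProjectionGames
import HarnessLib
/-!
# Parallel repetition, I: the product of projection games and Dinur–Steurer's multiplicativity bound

Topic `Computability/Complexity`, namespace `Literature.Computability.Complexity.ProjGame`.
Dinur–Steurer, *Analytical approach to parallel repetition* (STOC 2014; arXiv:1305.1979), §2.2 and
Theorem 3.2, PROVED, in the supremum-free form in which it is used:

* `prod G H` — the direct product `G ⊗ H` of two projection games (§2.2: "the referee chooses
  `(u, v, π)` from `G` and `(u', v', π')` from `H` independently … the players succeed if both
  `α ↤ β` and `α' ↤ β'`"), with product weights; `pow G k = G ⊗ ⋯ ⊗ G` on nested tuples `NProd`.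
* `LamLe G c` — the hypothesis "`λ₊(G)² ≤ c`" of Def. 3.1 without a supremum:
  `‖G h‖² ≤ c · ‖T h‖²` for every nonnegative `h`.
* **Theorem 3.2** (`normG_prod_le`): if `‖G h‖² ≤ c ‖T h‖²` for all `h ≥ 0`, then for every
  nonnegative `f` on the product game, `‖(G ⊗ H) f‖² ≤ c · 𝔼_v ‖H f_v‖²`, where `f_v` ("`row f v`")
  sums out Bob's `G`-label — the printed proof: factor `G ⊗ H = (G ⊗ Id)(Id ⊗ H)`, expand the
  squared norms column by column (`h_j`, `j ∈ U' × Σ'`), apply the hypothesis to every column.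
  (The printed statement `‖G ⊗ H‖ ≤ λ₊(G) · ‖H‖` follows by taking `f` optimal and bounding
  `‖H f_v‖ ≤ ‖H‖`; the form here avoids maxima over the compact set of assignments.)
* `normG_pow_le`, `valLe_pow` — by induction, `‖G^{⊗k} f‖² ≤ c^k` for fractional assignments and
  hence (Claim 2.3) `val(G^{⊗k}) ≤ (√c)^k`; `sat_pow` — a satisfiable game has satisfiable powers.

## References

* I. Dinur, D. Steurer, *Analytical approach to parallel repetition*, Proc. 46th STOC (2014)
  624–633; arXiv:1305.1979: §2.2 (Claim 2.2), Def. 3.1, Thm. 3.2 and its proof (§3.1).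
-/

namespace Literature.Computability.Complexity

open Finset

namespace ProjGame

variable {E V U β α : Type} [Fintype E] [Fintype V] [Fintype U] [Fintype β] [Fintype α]
  [DecidableEq V] [DecidableEq U] [DecidableEq β] [DecidableEq α]
variable {E' V' U' β' α' : Type} [Fintype E'] [Fintype V'] [Fintype U'] [Fintype β'] [Fintype α']
  [DecidableEq V'] [DecidableEq U'] [DecidableEq β'] [DecidableEq α']

/-! ### The unnormalised operator -/

section AppW

variable (G : ProjGame E V U β α)

/-- The unnormalised operator `wU u · (G f)(u, α) = ∑_{e : dst e = u} w_e · lift f e α`. [cite: DinurSteurer2014, §2.1] -/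
def appW (f : V → β → ℝ) (u : U) (a : α) : ℝ :=
  ∑ e, if G.dst e = u then G.wt e * G.lift f e a else 0

omit [Fintype V] [Fintype U] [Fintype α] [DecidableEq V] [DecidableEq β] in
/-- `app f u a = appW f u a / wU u` (definitional). [cite: DinurSteurer2014, §2.1] -/
theorem app_eq_appW_div (f : V → β → ℝ) (u : U) (a : α) : G.app f u a = G.appW f u a / G.wU u := rfl

omit [Fintype V] [Fintype U] [Fintype α] [DecidableEq V] [DecidableEq β] in
/-- `appW` is homogeneous. [folklore] -/
theorem appW_smul (c : ℝ) (f : V → β → ℝ) (u : U) (a : α) : G.appW (c • f) u a = c * G.appW f u a := by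
  have h := G.app_smul c f u a
  rw [app_eq_appW_div, app_eq_appW_div, mul_div_assoc'] at h
  exact (div_left_inj' (G.wU_pos u).ne').1 h

omit [Fintype V] [Fintype U] [Fintype α] [DecidableEq V] [DecidableEq β] in
/-- `appW` commutes with finite sums of functions. [folklore] -/
theorem appW_sum {ι : Type} (s : Finset ι) (f : ι → V → β → ℝ) (u : U) (a : α) :
    G.appW (∑ i ∈ s, f i) u a = ∑ i ∈ s, G.appW (f i) u a := by
  have h := G.app_sum s f u a
  simp only [app_eq_appW_div] at h
  rw [← sum_div] at h
  exact (div_left_inj' (G.wU_pos u).ne').1 h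

omit [Fintype V] [Fintype U] [Fintype α] [DecidableEq V] [DecidableEq β] in
/-- `appW` written with the projection condition inside: `∑_e [dst e = u] w_e ∑_β [π_e β = α] f(src e, β)`. [folklore] -/
theorem appW_eq (f : V → β → ℝ) (u : U) (a : α) :
    G.appW f u a = ∑ e, if G.dst e = u then G.wt e * ∑ b, (if G.proj e b = some a then f (G.src e) b else 0) else 0 :=
  rfl

end AppW

/-! ### The product game -/

section Prod

variable (G : ProjGame E V U β α) (H : ProjGame E' V' U' β' α')

/-- The product of two projection constraints: `(β, β') ↦ (α, α')` iff `β ↦ α` and `β' ↦ α'`. [cite: DinurSteurer2014, §2.2] -/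
def prodProj (π : β → Option α) (π' : β' → Option α') (b : β × β') : Option (α × α') :=
  (π b.1).bind fun a => (π' b.2).map fun a' => (a, a')

omit [Fintype β] [Fintype α] [DecidableEq β] [DecidableEq α] [Fintype β'] [Fintype α'] [DecidableEq β']
  [DecidableEq α'] in
/-- The product constraint accepts `(α, α')` on `(β, β')` iff both factors accept. [cite: DinurSteurer2014, §2.2] -/
theorem prodProj_eq_some_iff (π : β → Option α) (π' : β' → Option α') (b : β × β') (a : α × α') :
    prodProj π π' b = some a ↔ π b.1 = some a.1 ∧ π' b.2 = some a.2 := by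
  obtain ⟨a, a'⟩ := a
  unfold prodProj
  cases π b.1 with
  | none => simp
  | some x =>
    cases π' b.2 with
    | none => simp
    | some y => simp [Prod.ext_iff]

/-- **The direct product `G ⊗ H`** of two projection games (Dinur–Steurer §2.2): vertex sets
`V × V'` (Bob) and `U × U'` (Alice), alphabets `β × β'`, `α × α'`, an edge for each pair of edges,
with the product weight (the two edges are drawn independently) and the product constraint.
[cite: DinurSteurer2014, §2.2 (Claim 2.2)] -/
def prod : ProjGame (E × E') (V × V') (U × U') (β × β') (α × α') where
  src e := (G.src e.1, H.src e.2)
  dst e := (G.dst e.1, H.dst e.2)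
  proj e := prodProj (G.proj e.1) (H.proj e.2)
  wt e := G.wt e.1 * H.wt e.2
  wt_pos e := mul_pos (G.wt_pos e.1) (H.wt_pos e.2)
  src_surj v := by
    obtain ⟨e, he⟩ := G.src_surj v.1
    obtain ⟨e', he'⟩ := H.src_surj v.2
    exact ⟨(e, e'), Prod.ext he he'⟩
  dst_surj u := by
    obtain ⟨e, he⟩ := G.dst_surj u.1
    obtain ⟨e', he'⟩ := H.dst_surj u.2
    exact ⟨(e, e'), Prod.ext he he'⟩

omit [Fintype V] [Fintype U] [Fintype β] [Fintype α] [DecidableEq V] [DecidableEq U] [DecidableEq β] [DecidableEq α] [Fintype V'] [Fintype U'] [Fintype β'] [Fintype α'] [DecidableEq V'] [DecidableEq U'] [DecidableEq β'] [DecidableEq α'] in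
/-- The total weight of the product is the product of the total weights. [cite: DinurSteurer2014, §2.2] -/
theorem total_prod : (G.prod H).total = G.total * H.total := by
  unfold total
  rw [Fintype.sum_prod_type, sum_mul_sum]
  rfl

omit [Fintype V] [Fintype U] [Fintype β] [Fintype α] [DecidableEq V] [DecidableEq β] [DecidableEq α] [Fintype V'] [Fintype U'] [Fintype β'] [Fintype α'] [DecidableEq V'] [DecidableEq β'] [DecidableEq α'] in
/-- `wU (u, u') = wU u · wU u'` in the product. [cite: DinurSteurer2014, §2.2] -/
theorem wU_prod (u : U) (u' : U') : (G.prod H).wU (u, u') = G.wU u * H.wU u' := by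
  unfold wU
  rw [Fintype.sum_prod_type, sum_mul_sum]
  refine sum_congr rfl fun e _ => sum_congr rfl fun e' _ => ?_
  show (if (G.dst e, H.dst e') = (u, u') then G.wt e * H.wt e' else 0) = _
  by_cases h1 : G.dst e = u <;> by_cases h2 : H.dst e' = u' <;> simp [h1, h2]

omit [Fintype V] [Fintype U] [Fintype β] [Fintype α] [DecidableEq U] [DecidableEq β] [DecidableEq α] [Fintype V'] [Fintype U'] [Fintype β'] [Fintype α'] [DecidableEq U'] [DecidableEq β'] [DecidableEq α'] in
/-- `wV (v, v') = wV v · wV v'` in the product. [cite: DinurSteurer2014, §2.2] -/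
theorem wV_prod (v : V) (v' : V') : (G.prod H).wV (v, v') = G.wV v * H.wV v' := by
  unfold wV
  rw [Fintype.sum_prod_type, sum_mul_sum]
  refine sum_congr rfl fun e _ => sum_congr rfl fun e' _ => ?_
  show (if (G.src e, H.src e') = (v, v') then G.wt e * H.wt e' else 0) = _
  by_cases h1 : G.src e = v <;> by_cases h2 : H.src e' = v' <;> simp [h1, h2]

omit [Fintype V] [Fintype β] [Fintype α] [DecidableEq V] [DecidableEq β] [DecidableEq α] [Fintype V'] [Fintype β'] [Fintype α'] [DecidableEq V'] [DecidableEq β'] [DecidableEq α'] in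
/-- `∑_u μ_U(u) · g u` over the product splits. [folklore] -/
theorem sum_mu_prod (g : U × U' → ℝ) :
    ∑ p, (G.prod H).wU p / (G.prod H).total * g p =
      ∑ u', H.wU u' / H.total * ∑ u, G.wU u / G.total * g (u, u') := by
  rw [Fintype.sum_prod_type, sum_comm]
  refine sum_congr rfl fun u' _ => ?_
  rw [mul_sum]
  refine sum_congr rfl fun u _ => ?_
  rw [wU_prod, total_prod, mul_div_mul_comm]
  ring

/-- The restriction `f^{v,β}` of a function on the product to a fixed Bob vertex and label of `G`. [cite: DinurSteurer2014, Thm. 3.2 (proof)] -/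
def slice (f : V × V' → β × β' → ℝ) (v : V) (b : β) : V' → β' → ℝ := fun v' b' => f (v, v') (b, b')

/-- The "row" `f_v(v', β') = ∑_β f((v, v'), (β, β'))`: summing out Bob's `G`-label (the assignment
for `H` induced at the vertex `v`, as in Claim 2.4 / the proof of Thm. 3.2). [cite: DinurSteurer2014, Thm. 3.2 (proof)] -/
def row (f : V × V' → β × β' → ℝ) (v : V) : V' → β' → ℝ := fun v' b' => ∑ b, f (v, v') (b, b')

/-- The "column" `h_j`, `j = (u', α')`, of `h = (Id ⊗ H) f`: `h_j(v, β) = (H f^{v,β})(u', α')`. [cite: DinurSteurer2014, Thm. 3.2 (proof)] -/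
noncomputable def col (f : V × V' → β × β' → ℝ) (u' : U') (a' : α') : V → β → ℝ :=
  fun v b => H.app (slice f v b) u' a'

omit [Fintype V] [DecidableEq V] [DecidableEq β] [Fintype V'] [Fintype β'] [DecidableEq V'] [DecidableEq β'] in
/-- `row f v = ∑_β f^{v,β}`. [folklore] -/
theorem row_eq_sum_slice (f : V × V' → β × β' → ℝ) (v : V) : row f v = ∑ b, slice f v b := by
  funext v' b'
  simp only [row, slice, Finset.sum_apply]

omit [Fintype V] [DecidableEq V] [DecidableEq β] [Fintype V'] [Fintype β'] [DecidableEq V'] [DecidableEq β'] in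
/-- Rows of a nonnegative function are nonnegative. [folklore] -/
theorem row_nonneg {f : V × V' → β × β' → ℝ} (hf : Nonneg f) (v : V) : Nonneg (row f v) :=
  fun _ _ => sum_nonneg fun _ _ => hf _ _

omit [Fintype V] [DecidableEq V] [DecidableEq β] [Fintype V'] [DecidableEq V'] [DecidableEq β'] in
/-- Rows of a fractional assignment (row sums `≤ 1`) have row sums `≤ 1`. [folklore] -/
theorem sum_row_le {f : V × V' → β × β' → ℝ} (hf1 : ∀ p, ∑ q, f p q ≤ 1) (v : V) (v' : V') :
    ∑ b', row f v v' b' ≤ 1 := by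
  have h : ∑ b', row f v v' b' = ∑ q : β × β', f (v, v') q := by
    unfold row
    rw [Fintype.sum_prod_type]
    exact sum_comm
  rw [h]
  exact hf1 _

omit [Fintype V] [Fintype β] [DecidableEq V] [DecidableEq β] in
omit [Fintype V'] [Fintype U'] [Fintype α'] [DecidableEq V'] [DecidableEq β'] in
/-- Columns of a nonnegative function are nonnegative. [folklore] -/
theorem col_nonneg {f : V × V' → β × β' → ℝ} (hf : Nonneg f) (u' : U') (a' : α') :
    Nonneg (H.col f u' a' : V → β → ℝ) :=
  fun _ _ => H.app_nonneg (fun _ _ => hf _ _) u' a'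

omit [Fintype V] [Fintype U] [Fintype α] [DecidableEq V] [DecidableEq β] [Fintype V'] [Fintype U'] [Fintype α'] [DecidableEq V'] [DecidableEq β'] in
/-- **Factorisation `G ⊗ H = (G ⊗ Id)(Id ⊗ H)`**, unnormalised: `(G ⊗ H)_W f ((u,u'),(α,α')) =
G_W [ (v, β) ↦ H_W f^{v,β} (u', α') ] (u, α)`. [cite: DinurSteurer2014, §3.1 (factorisation) and Claim 2.2] -/
theorem appW_prod (f : V × V' → β × β' → ℝ) (u : U) (u' : U') (a : α) (a' : α') :
    (G.prod H).appW f (u, u') (a, a') = G.appW (fun v b => H.appW (slice f v b) u' a') u a := by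
  rw [appW_eq, appW_eq, Fintype.sum_prod_type]
  refine sum_congr rfl fun e _ => ?_
  show (∑ e', if (G.dst e, H.dst e') = (u, u') then G.wt e * H.wt e' *
      ∑ q, (if prodProj (G.proj e) (H.proj e') q = some (a, a') then f (G.src e, H.src e') q else 0) else 0) = _
  by_cases he : G.dst e = u
  · simp only [he, Prod.mk.injEq, true_and, if_true]
    rw [mul_sum]
    simp only [appW_eq, slice, mul_ite_zero, mul_sum]
    simp only [Finset.ite_sum_zero]
    conv_rhs => rw [sum_comm]
    refine sum_congr rfl fun e' _ => ?_
    by_cases he' : H.dst e' = u'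
    · simp only [he', if_true]
      rw [Fintype.sum_prod_type]
      refine sum_congr rfl fun b _ => sum_congr rfl fun b' _ => ?_
      simp only [prodProj_eq_some_iff]
      by_cases hb : G.proj e b = some a <;> by_cases hb' : H.proj e' b' = some a' <;> simp [hb, hb', mul_assoc]
    · simp [he']
  · simp only [he, Prod.mk.injEq, false_and, if_false, sum_const_zero]

omit [Fintype V'] [Fintype U'] [Fintype α'] [DecidableEq V'] [DecidableEq β'] in
omit [Fintype V] [Fintype U] [Fintype α] [DecidableEq V] [DecidableEq β] in
/-- The same for the normalised operator: `(G ⊗ H) f ((u,u'),(α,α')) = (G h_{(u',α')})(u, α)`. [cite: DinurSteurer2014, Thm. 3.2 (proof)] -/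
theorem app_prod (f : V × V' → β × β' → ℝ) (u : U) (u' : U') (a : α) (a' : α') :
    (G.prod H).app f (u, u') (a, a') = G.app (H.col f u' a') u a := by
  rw [app_eq_appW_div, app_eq_appW_div, wU_prod, appW_prod]
  have hcol : H.col f u' a' = (H.wU u')⁻¹ • fun v b => H.appW (slice f v b) u' a' := by
    funext v b
    simp only [col, Pi.smul_apply, smul_eq_mul, app_eq_appW_div]
    rw [inv_mul_eq_div]
  rw [hcol, appW_smul]
  field_simp

omit [Fintype V] [DecidableEq V] [DecidableEq β] in
omit [Fintype V'] [Fintype U'] [Fintype α'] [DecidableEq V'] [DecidableEq β'] in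
/-- Row sums of the columns: `∑_β h_{(u',α')}(v, β) = (H f_v)(u', α')`. [cite: DinurSteurer2014, Thm. 3.2 (proof)] -/
theorem sum_col (f : V × V' → β × β' → ℝ) (u' : U') (a' : α') (v : V) :
    ∑ b, H.col f u' a' v b = H.app (row f v) u' a' := by
  simp only [col]
  rw [row_eq_sum_slice, H.app_sum]

omit [Fintype V'] [DecidableEq V'] [DecidableEq β'] in
omit [Fintype V] [DecidableEq V] [DecidableEq β] in
/-- **`‖(G ⊗ H) f‖²` column by column**: `= 𝔼_{u'} ∑_{α'} ‖G h_{(u',α')}‖²`. [cite: DinurSteurer2014, Thm. 3.2 (proof)] -/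
theorem normG_prod_eq (f : V × V' → β × β' → ℝ) :
    (G.prod H).normG f = ∑ u', H.wU u' / H.total * ∑ a', G.normG (H.col f u' a') := by
  unfold normG
  rw [sum_mu_prod]
  refine sum_congr rfl fun u' _ => ?_
  congr 1
  conv_rhs => rw [sum_comm]
  refine sum_congr rfl fun u _ => ?_
  rw [← mul_sum]
  congr 1
  rw [Fintype.sum_prod_type]
  conv_lhs => rw [sum_comm]
  refine sum_congr rfl fun a' _ => sum_congr rfl fun a _ => ?_
  rw [app_prod]

/-- Summation helper: `∑_{a'} ∑_v μ_v T(a', v) = ∑_v μ_v ∑_{a'} T(a', v)`. [folklore] -/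
theorem sum_sum_mul_comm {ι κ : Type} [Fintype ι] [Fintype κ] (μ : κ → ℝ) (T : ι → κ → ℝ) :
    ∑ i, ∑ v, μ v * T i v = ∑ v, μ v * ∑ i, T i v := by
  rw [sum_comm]
  exact sum_congr rfl fun v _ => by rw [mul_sum]

/-- Summation helper: `∑_{u'} μ'_{u'} ∑_v μ_v S(u', v) = ∑_v μ_v ∑_{u'} μ'_{u'} S(u', v)`. [folklore] -/
theorem sum_mul_sum_mul_comm {ι κ : Type} [Fintype ι] [Fintype κ] (μ' : ι → ℝ) (μ : κ → ℝ) (S : ι → κ → ℝ) :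
    ∑ i, μ' i * ∑ v, μ v * S i v = ∑ v, μ v * ∑ i, μ' i * S i v := by
  simp only [mul_sum]
  rw [sum_comm]
  exact sum_congr rfl fun v _ => sum_congr rfl fun i _ => by ring

omit [Fintype U] [Fintype α] [DecidableEq U] [DecidableEq β] [DecidableEq α] in
omit [Fintype V'] [DecidableEq V'] [DecidableEq β'] in
/-- **`‖(T ⊗ Id) h‖²` column by column equals `𝔼_v ‖H f_v‖²`.** [cite: DinurSteurer2014, Thm. 3.2 (proof)] -/
theorem sum_normT_col_eq (f : V × V' → β × β' → ℝ) :
    ∑ u', H.wU u' / H.total * ∑ a', G.normT (H.col f u' a') = ∑ v, G.wV v / G.total * H.normG (row f v) := by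
  unfold normT normG
  simp_rw [sum_col]
  simp_rw [sum_sum_mul_comm (fun v => G.wV v / G.total)]
  rw [sum_mul_sum_mul_comm]

/-- "`λ₊(G)² ≤ c`" without the supremum of Def. 3.1: every nonnegative `h` has `‖G h‖² ≤ c · ‖T h‖²`. [cite: DinurSteurer2014, Def. 3.1] -/
def LamLe (c : ℝ) : Prop := ∀ h : V → β → ℝ, Nonneg h → G.normG h ≤ c * G.normT h

omit [DecidableEq β] [Fintype V'] [DecidableEq V'] [DecidableEq β'] in
/-- **Dinur–Steurer, Theorem 3.2 (multiplicativity of `λ₊`), supremum-free form.** If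
`‖G h‖² ≤ c ‖T h‖²` for every `h ≥ 0`, then for every nonnegative `f` on `G ⊗ H`,
`‖(G ⊗ H) f‖² ≤ c · 𝔼_v ‖H f_v‖²`. Printed proof: "`‖(G ⊗ Id) h‖² / ‖(T ⊗ Id) h‖² =
𝔼_j ‖G h_j‖² / 𝔼_j ‖T h_j‖²`; an averaging argument …". [cite: DinurSteurer2014, Thm. 3.2] -/
theorem normG_prod_le {c : ℝ} (hc : G.LamLe c) {f : V × V' → β × β' → ℝ}
    (hf : Nonneg f) : (G.prod H).normG f ≤ c * ∑ v, G.wV v / G.total * H.normG (row f v) := by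
  rw [normG_prod_eq, ← sum_normT_col_eq, mul_sum]
  refine sum_le_sum fun u' _ => ?_
  rw [← mul_assoc, mul_comm c, mul_assoc]
  refine mul_le_mul_of_nonneg_left ?_ (div_nonneg (H.wU_pos u').le H.total_nonneg)
  rw [mul_sum]
  exact sum_le_sum fun a' _ => hc _ (H.col_nonneg hf u' a')

omit [Fintype E] [Fintype V] [Fintype U] [Fintype β] [Fintype α] [DecidableEq V] [DecidableEq U] [DecidableEq β] [DecidableEq α] [Fintype E'] [Fintype V'] [Fintype U'] [Fintype β'] [Fintype α'] [DecidableEq V'] [DecidableEq U'] [DecidableEq β'] [DecidableEq α'] in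
/-- The product of satisfiable games is satisfiable. [cite: DinurSteurer2014, §2.2] -/
theorem sat_prod {b : V → β} {a : U → α} {b' : V' → β'} {a' : U' → α'}
    (h : ∀ e, G.proj e (b (G.src e)) = some (a (G.dst e)))
    (h' : ∀ e', H.proj e' (b' (H.src e')) = some (a' (H.dst e'))) :
    ∀ p, (G.prod H).proj p ((fun v => (b v.1, b' v.2)) ((G.prod H).src p)) =
      some ((fun u => (a u.1, a' u.2)) ((G.prod H).dst p)) := fun p => by
  show prodProj (G.proj p.1) (H.proj p.2) (b (G.src p.1), b' (H.src p.2)) = some (a (G.dst p.1), a' (H.dst p.2))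
  rw [prodProj_eq_some_iff]
  exact ⟨h p.1, h' p.2⟩

end Prod

/-! ### Nested tuples and the `k`-fold product -/

/-- Nested `k`-tuples `X × (X × ⋯ × Unit)` (the vertex/label/edge types of `G^{⊗k}`); reducible, so
that `NProd X 0 = Unit` and `NProd X (k+1) = X × NProd X k` are seen by instance search. [folklore] -/
@[reducible] def NProd (X : Type) : ℕ → Type
  | 0 => Unit
  | k + 1 => X × NProd X k

namespace NProd

/-- `NProd X k` is finite. [folklore] -/
instance instFintype (X : Type) [Fintype X] : (k : ℕ) → Fintype (NProd X k)
  | 0 => inferInstanceAs (Fintype Unit)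
  | k + 1 => @instFintypeProd X (NProd X k) _ (instFintype X k)

/-- `NProd X k` has decidable equality. [folklore] -/
instance instDecidableEq (X : Type) [DecidableEq X] : (k : ℕ) → DecidableEq (NProd X k)
  | 0 => inferInstanceAs (DecidableEq Unit)
  | k + 1 => @instDecidableEqProd X (NProd X k) _ (instDecidableEq X k)

/-- `NProd X k` is nonempty when `X` is. [folklore] -/
instance instNonempty (X : Type) [Nonempty X] : (k : ℕ) → Nonempty (NProd X k)
  | 0 => inferInstanceAs (Nonempty Unit)
  | k + 1 => @instNonemptyProd X (NProd X k) _ (instNonempty X k)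

end NProd

section Pow

/-- The one-point game (the unit for `⊗`): one edge of weight `1`, one label on each side, always
accepted. [folklore] -/
def unit : ProjGame Unit Unit Unit Unit Unit where
  src _ := ()
  dst _ := ()
  proj _ _ := some ()
  wt _ := 1
  wt_pos _ := one_pos
  src_surj _ := ⟨(), rfl⟩
  dst_surj _ := ⟨(), rfl⟩

variable (G : ProjGame E V U β α)

/-- **The `k`-fold parallel repetition `G^{⊗k}`** (`G^{⊗0}` the one-point game,
`G^{⊗(k+1)} = G ⊗ G^{⊗k}`). [cite: DinurSteurer2014, §2.2] -/
def pow : (k : ℕ) → ProjGame (NProd E k) (NProd V k) (NProd U k) (NProd β k) (NProd α k)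
  | 0 => unit
  | k + 1 => G.prod (pow k)

omit [Fintype E] [Fintype V] [Fintype U] [Fintype β] [Fintype α] [DecidableEq V] [DecidableEq U] [DecidableEq β] [DecidableEq α] in
/-- `G^{⊗0}` is the one-point game. [folklore] -/
theorem pow_zero_def : G.pow 0 = unit := rfl

omit [Fintype E] [Fintype V] [Fintype U] [Fintype β] [Fintype α] [DecidableEq V] [DecidableEq U] [DecidableEq β] [DecidableEq α] in
/-- `G^{⊗(k+1)} = G ⊗ G^{⊗k}`. [folklore] -/
theorem pow_succ_def (k : ℕ) : G.pow (k + 1) = G.prod (G.pow k) := rfl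

omit [Fintype E] [Fintype V] [Fintype U] [Fintype β] [Fintype α] [DecidableEq V] [DecidableEq U] [DecidableEq β] [DecidableEq α] in
/-- In the one-point game `G^{⊗0}`, `‖G^{⊗0} f‖² = f((),())²`. [folklore] -/
theorem normG_pow_zero (f : NProd V 0 → NProd β 0 → ℝ) : (G.pow 0).normG f = f () () ^ 2 := by
  simp [normG, app, lift, wU, total, pow, unit]

omit [DecidableEq β] in
/-- **`‖G^{⊗k} f‖² ≤ c^k` for fractional assignments** (`f ≥ 0`, row sums `≤ 1`), given
`‖G h‖² ≤ c ‖T h‖²` for all `h ≥ 0`: Theorem 3.2 `k` times ("by repeated application").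
[cite: DinurSteurer2014, §3.3 (proof of the hardness of label cover: "repeated applications" of Thm. 3.2)] -/
theorem normG_pow_le [Nonempty E] {c : ℝ} (hc0 : 0 ≤ c) (hc : G.LamLe c) :
    ∀ (k : ℕ) (f : NProd V k → NProd β k → ℝ), Nonneg f → (∀ v, ∑ b, f v b ≤ 1) →
      (G.pow k).normG f ≤ c ^ k
  | 0, f, hf, hf1 => by
    rw [normG_pow_zero, _root_.pow_zero]
    have h0 : 0 ≤ f () () := hf () ()
    have h1 : f () () ≤ 1 := by simpa using hf1 ()
    nlinarith
  | k + 1, f, hf, hf1 => by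
    rw [pow_succ_def]
    haveI : Nonempty (NProd E k) := inferInstance
    refine (G.normG_prod_le (G.pow k) hc hf).trans ?_
    rw [_root_.pow_succ']
    refine mul_le_mul_of_nonneg_left ?_ hc0
    calc ∑ v, G.wV v / G.total * (G.pow k).normG (row f v)
        ≤ ∑ v, G.wV v / G.total * c ^ k :=
          sum_le_sum fun v _ => mul_le_mul_of_nonneg_left
            (normG_pow_le hc0 hc k (row f v) (row_nonneg hf v) (sum_row_le hf1 v))
            (div_nonneg (G.wV_pos v).le G.total_nonneg)
      _ = c ^ k := by rw [← sum_mul, sum_wV_div_total, one_mul]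

/-- **Parallel repetition bound from `λ₊`**: if `‖G h‖² ≤ c ‖T h‖²` for all `h ≥ 0` (`0 ≤ c`),
then `val(G^{⊗k}) ≤ (√c)^k` — Claim 2.3 (`val ≤ ‖·‖`) and `normG_pow_le`.
[cite: DinurSteurer2014, §3.3 (proof of the hardness of label cover)] -/
theorem valLe_pow [Nonempty E] {c : ℝ} (hc0 : 0 ≤ c) (hc : G.LamLe c) (k : ℕ) :
    (G.pow k).ValLe (Real.sqrt c ^ k) := by
  intro b a
  haveI : Nonempty (NProd E k) := inferInstance
  have hpos := (G.pow k).total_pos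
  have h1 := (G.pow k).sq_satW_div_le_normG b a
  have h2 := G.normG_pow_le hc0 hc k (indic b) (indic_nonneg b) (fun v => (sum_indic b v).le)
  have hy : 0 ≤ Real.sqrt c ^ k := pow_nonneg (Real.sqrt_nonneg c) k
  have hsq : (Real.sqrt c ^ k) ^ 2 = c ^ k := by
    rw [← pow_mul, mul_comm, pow_mul, Real.sq_sqrt hc0]
  have h3 : (G.pow k).satW b a / (G.pow k).total ≤ Real.sqrt c ^ k :=
    (abs_le_of_sq_le_sq' (by rw [hsq]; exact h1.trans h2) hy).2
  rwa [div_le_iff₀ hpos] at h3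

omit [Fintype E] [Fintype V] [Fintype U] [Fintype β] [Fintype α] [DecidableEq V] [DecidableEq U] [DecidableEq β] [DecidableEq α] in
/-- A satisfiable game has satisfiable parallel repetitions. [cite: DinurSteurer2014, §3.3 ("if `val(G) = 1` clearly `val(G^{⊗k}) = 1`")] -/
theorem sat_pow {b : V → β} {a : U → α} (h : ∀ e, G.proj e (b (G.src e)) = some (a (G.dst e))) :
    ∀ k : ℕ, ∃ (bk : NProd V k → NProd β k) (ak : NProd U k → NProd α k),
      ∀ p, (G.pow k).proj p (bk ((G.pow k).src p)) = some (ak ((G.pow k).dst p))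
  | 0 => ⟨fun _ => (), fun _ => (), fun _ => rfl⟩
  | k + 1 => by
    obtain ⟨bk, ak, hk⟩ := sat_pow h k
    exact ⟨fun v => (b v.1, bk v.2), fun u => (a u.1, ak u.2), G.sat_prod (G.pow k) h hk⟩

omit [Fintype V] [Fintype U] [Fintype β] [Fintype α] [DecidableEq V] [DecidableEq U] [DecidableEq β] in
/-- In a satisfiable game `val = 1`: some strategies satisfy weight `total`. [folklore] -/
theorem satW_eq_total_of_sat {b : V → β} {a : U → α} (h : ∀ e, G.proj e (b (G.src e)) = some (a (G.dst e))) :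
    G.satW b a = G.total := by
  unfold satW total
  exact sum_congr rfl fun e _ => if_pos (h e)

end Pow

end ProjGame

end Literature.Computability.Complexity
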